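/-
Origin: expansion seat `planner-pub-hodgecm-pv09-g4-0`, handover #9 2026-08-18T07:54:04Z (`HOME/pub-hodgecm-pv09-g4/lean/Pv09g4/RestrictedUnits.lean`, md5 df119f3f, 236 lines);
landed by the gen-7 packager in gate run 26 as `HodgeCM/PerL34/RestrictedUnits.lean` (verbatim).
-/
/-
HodgeCM / PerL34 publication cell — seam S3 set-up, model side (pub-hodgecm-pv09-g4, HANDOVER #9).
Imports: Mathlib and the tree module `HodgeCM.PerL34.IdeleClassGroup` (pv10, run 20: `Units.isOpenEmbedding_map`,
`NumberField.ideleGroupSplit`).  Complete proofs, no new axioms, nothing cited.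
-/
import Mathlib.Topology.Algebra.RestrictedProduct.Units
import Mathlib.Topology.Algebra.RestrictedProduct.TopologicalSpace
import Mathlib.Topology.Algebra.ContinuousMonoidHom
import Mathlib.Topology.Algebra.Group.Units
import Mathlib.RingTheory.DedekindDomain.FiniteAdeleRing
import Summits.HodgeConjecture.HodgeCM.PerL34.IdeleClassGroup

/-!
# Units of a restricted product are the restricted product of the units — TOPOLOGICALLY

Mathlib's `RestrictedProduct.unitsEquiv : (Πʳ i, [R i, B i])ˣ ≃* Πʳ i, [(R i)ˣ, (B i).units]` is an
isomorphism of monoids only.  For topological monoids `R i` with OPEN submonoids `B i` it is an isomorphism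
of TOPOLOGICAL groups — the units carrying Mathlib's units topology (the embedding `u ↦ (u, u⁻¹)` into
`R × Rᵐᵒᵖ`), the right-hand side the restricted product topology:

* `continuous_of_isOpenMap_comp` — a homomorphism of topological groups is continuous as soon as its
  composite with some OPEN map `i` with `i p₀ = 1` is continuous at `p₀`;
* (Mathlib `Submonoid.isOpen_units`: `S.units ⊆ Mˣ` is open for an open submonoid `S ⊆ M`;)
* **`unitsContinuousMulEquiv : (Πʳ i, [R i, B i])ˣ ≃ₜ* Πʳ i, [(R i)ˣ, (B i).units]`** — continuity of
  `unitsEquiv` is tested on the open subgroup `(Π i, B i)ˣ ↪ (Πʳ i, [R i, B i])ˣ` (pv10's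
  `Units.isOpenEmbedding_map` of Mathlib's `RestrictedProduct.isOpenEmbedding_structureMap`), continuity of
  its inverse on the open subgroup `Π i, (B i).units ↪ Πʳ i, [(R i)ˣ, (B i).units]`, where both composites
  are products of coordinate maps;
* `finiteAdeleUnitsEquiv R K : (FiniteAdeleRing R K)ˣ ≃ₜ* Πʳ v, [(K_v)ˣ, (𝒪_v).units]` — the finite
  ideles of a Dedekind domain ARE the restricted product of the `K_vˣ` with respect to the `𝒪_vˣ`, as
  topological groups; with pv10's `ideleGroupSplit`, `ideleGroupEquiv K : 𝔸_Kˣ ≃ₜ (K_∞)ˣ × Πʳ_v [(K_v)ˣ, (𝒪_v).units]`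
  for a number field `K`.

This is the first brick of the S3 model isomorphism (GAPS pv09g4-A5): the idelic torus
`U(1)_{L/K}(𝔸_K) ≤ 𝔸_Lˣ` of pv11-g4 becomes a subgroup of a genuine restricted product over the places of `L`.
-/

set_option autoImplicit false

noncomputable section

open Topology Filter Set
open scoped RestrictedProduct

namespace HodgeCM.PerL34.RestrictedUnits

/-! ## §1  A continuity criterion for homomorphisms -/

section general

/-- A homomorphism of topological groups is continuous as soon as its composite with some OPEN map `i`
hitting `1` at `p₀` is continuous at `p₀`. -/
theorem continuous_of_isOpenMap_comp {G H P : Type*} [Group G] [TopologicalSpace G] [IsTopologicalGroup G]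
    [Group H] [TopologicalSpace H] [IsTopologicalGroup H] [TopologicalSpace P] (f : G →* H) (i : P → G)
    (hi : IsOpenMap i) {p₀ : P} (hp : i p₀ = 1) (hc : ContinuousAt (f ∘ i) p₀) : Continuous f := by
  refine continuous_of_continuousAt_one f ?_
  rw [ContinuousAt, ← hp]
  intro N hN
  have hN' : (f ∘ i) ⁻¹' N ∈ 𝓝 p₀ := hc hN
  obtain ⟨O, hO, hOo, hp₀⟩ := mem_nhds_iff.mp hN'
  refine Filter.mem_map.mpr (mem_of_superset ((hi O hOo).mem_nhds ⟨p₀, hp₀, rfl⟩) ?_)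
  rintro _ ⟨p, hp, rfl⟩
  exact hO hp

end general

/-! ## §2  `(Πʳ i, [R i, B i])ˣ ≃ₜ* Πʳ i, [(R i)ˣ, (B i).units]` -/

section units

variable {ι : Type*} {R : ι → Type*} [∀ i, Monoid (R i)] [∀ i, TopologicalSpace (R i)]
  {S : ι → Type*} [∀ i, SetLike (S i) (R i)] [∀ i, SubmonoidClass (S i) (R i)] {B : ∀ i, S i}

/-- The open submonoids `B i` have open unit groups `(B i).units ⊆ (R i)ˣ`. -/
theorem isOpen_units_ofClass (hBo : ∀ i, IsOpen (B i : Set (R i))) (i : ι) :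
    IsOpen (((Submonoid.ofClass (B i)).units : Subgroup (R i)ˣ) : Set (R i)ˣ) :=
  Submonoid.isOpen_units (U := Submonoid.ofClass (B i)) (hBo i)

/-- The structure map `Π i, B i → Πʳ i, [R i, B i]` as a monoid homomorphism. -/
def structureMonoidHom : (Π i, B i) →* Πʳ i, [R i, B i] where
  toFun := RestrictedProduct.structureMap R (fun i => (B i : Set (R i))) cofinite ∘
    fun x i => (⟨(x i : R i), (x i).2⟩ : (B i : Set (R i)))
  map_one' := rfl
  map_mul' _ _ := rfl

omit [∀ i, TopologicalSpace (R i)] in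
/-- (Ported verbatim from the HodgeCMPerL package; no docstring in the source.) -/
theorem structureMonoidHom_apply (x : Π i, B i) (i : ι) : structureMonoidHom (B := B) x i = (x i : R i) :=
  rfl

/-- (Ported verbatim from the HodgeCMPerL package; no docstring in the source.) -/
theorem isOpenEmbedding_structureMonoidHom (hBo : ∀ i, IsOpen (B i : Set (R i))) :
    IsOpenEmbedding (structureMonoidHom (B := B)) := by
  have h1 : IsOpenEmbedding (RestrictedProduct.structureMap R (fun i => (B i : Set (R i))) cofinite) :=
    RestrictedProduct.isOpenEmbedding_structureMap hBo
  have h2 : IsOpenEmbedding (fun (x : Π i, B i) (i : ι) => (⟨(x i : R i), (x i).2⟩ : (B i : Set (R i)))) :=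
    (Homeomorph.piCongrRight fun i => (Homeomorph.setCongr rfl : (B i : Set (R i)) ≃ₜ (B i : Set (R i)))).isOpenEmbedding
  exact h1.comp h2

/-- The coordinate unit `(x i : (R i)ˣ)` of a unit `x` of `Π i, B i`, inside `(B i).units`. -/
def piUnitCoord (x : (Π i, B i)ˣ) (i : ι) : ((Submonoid.ofClass (B i)).units : Subgroup (R i)ˣ) :=
  ⟨⟨(x.1 i : R i), (x.2 i : R i), by
      have h := congrArg (fun y : Π i, B i => (y i : R i)) x.3
      simpa using h, by
      have h := congrArg (fun y : Π i, B i => (y i : R i)) x.4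
      simpa using h⟩,
    (Submonoid.mem_units_iff _ _).mpr ⟨(x.1 i).2, (x.2 i).2⟩⟩

/-- (Ported verbatim from the HodgeCMPerL package; no docstring in the source.) -/
theorem continuous_piUnitCoord (i : ι) : Continuous fun x : (Π i, B i)ˣ => piUnitCoord x i := by
  refine Continuous.subtype_mk ?_ _
  refine Units.continuous_iff.mpr ⟨?_, ?_⟩
  · exact (continuous_subtype_val.comp ((continuous_apply i).comp Units.continuous_val))
  · exact (continuous_subtype_val.comp ((continuous_apply i).comp Units.continuous_coe_inv))

variable [∀ i, ContinuousMul (R i)] [hBopen : Fact (∀ i, IsOpen (B i : Set (R i)))]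

/-- The `Fact` that the unit groups `(B i).units` are open, for the topological-group instance of
`Πʳ i, [(R i)ˣ, (B i).units]`. -/
instance fact_isOpen_units :
    Fact (∀ i, IsOpen (((Submonoid.ofClass (B i)).units : Subgroup (R i)ˣ) : Set (R i)ˣ)) :=
  ⟨isOpen_units_ofClass hBopen.out⟩

/-- `unitsEquiv` is continuous (units topology → restricted product topology). -/
theorem continuous_unitsEquiv :
    Continuous (RestrictedProduct.unitsEquiv R (B := B) (𝓕 := cofinite)) := by
  classical
  -- test on the open subgroup `(Π i, B i)ˣ ↪ (Πʳ i, [R i, B i])ˣ`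
  have hopen : IsOpenEmbedding (Units.map (structureMonoidHom (B := B))) :=
    Units.isOpenEmbedding_map _ (isOpenEmbedding_structureMonoidHom hBopen.out)
  refine continuous_of_isOpenMap_comp (RestrictedProduct.unitsEquiv R (B := B) (𝓕 := cofinite)).toMonoidHom
    (Units.map (structureMonoidHom (B := B))) hopen.isOpenMap (p₀ := 1) (map_one _) ?_
  -- the composite is `structureMap ∘ piUnitCoord`, a continuous map
  have hcomp : ((RestrictedProduct.unitsEquiv R (B := B) (𝓕 := cofinite)).toMonoidHom ∘
      Units.map (structureMonoidHom (B := B)) : (Π i, B i)ˣ → _) =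
      RestrictedProduct.structureMap (fun i => (R i)ˣ)
        (fun i => (((Submonoid.ofClass (B i)).units : Subgroup (R i)ˣ) : Set (R i)ˣ)) cofinite ∘
        fun x i => piUnitCoord x i := by
    funext x
    ext i
    rfl
  rw [hcomp]
  exact ((RestrictedProduct.isEmbedding_structureMap.continuous).comp
    (continuous_pi fun i => continuous_piUnitCoord i)).continuousAt

/-- `unitsEquiv.symm` is continuous (restricted product topology → units topology). -/
theorem continuous_unitsEquiv_symm :
    Continuous (RestrictedProduct.unitsEquiv R (B := B) (𝓕 := cofinite)).symm := by
  classical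
  have hopen : IsOpenEmbedding (RestrictedProduct.structureMap (fun i => (R i)ˣ)
      (fun i => (((Submonoid.ofClass (B i)).units : Subgroup (R i)ˣ) : Set (R i)ˣ)) cofinite) :=
    RestrictedProduct.isOpenEmbedding_structureMap (isOpen_units_ofClass hBopen.out)
  refine continuous_of_isOpenMap_comp (RestrictedProduct.unitsEquiv R (B := B) (𝓕 := cofinite)).symm.toMonoidHom
    _ hopen.isOpenMap (p₀ := 1) rfl ?_
  refine Continuous.continuousAt ?_
  refine Units.continuous_iff.mpr ⟨?_, ?_⟩
  · -- `x ↦ (i ↦ (x i : R i))` = structureMap ∘ coordinatewise `val`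
    have h : (Units.val ∘ ((RestrictedProduct.unitsEquiv R (B := B) (𝓕 := cofinite)).symm.toMonoidHom ∘
        RestrictedProduct.structureMap (fun i => (R i)ˣ)
          (fun i => (((Submonoid.ofClass (B i)).units : Subgroup (R i)ˣ) : Set (R i)ˣ)) cofinite)) =
        RestrictedProduct.structureMap R (fun i => (B i : Set (R i))) cofinite ∘
          fun x i => (⟨((x i : (R i)ˣ) : R i), ((Submonoid.mem_units_iff _ _).mp (x i).2).1⟩ :
            (B i : Set (R i))) := by
      funext x
      rfl
    rw [h]
    exact RestrictedProduct.isEmbedding_structureMap.continuous.comp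
      (continuous_pi fun i => (Units.continuous_val.comp (continuous_subtype_val.comp
        (continuous_apply i))).subtype_mk _)
  · change Continuous (RestrictedProduct.structureMap R (fun i => (B i : Set (R i))) cofinite ∘
          fun (x : Π i, (((Submonoid.ofClass (B i)).units : Subgroup (R i)ˣ) : Set (R i)ˣ)) (i : ι) =>
            (⟨(((x i : (R i)ˣ)⁻¹ : (R i)ˣ) : R i), ((Submonoid.mem_units_iff _ _).mp (x i).2).2⟩ :
            (B i : Set (R i))))
    exact RestrictedProduct.isEmbedding_structureMap.continuous.comp
      (continuous_pi fun i => (Units.continuous_coe_inv.comp (continuous_subtype_val.comp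
        (continuous_apply i))).subtype_mk _)

variable (R B) in
/-- **Units of a restricted product = restricted product of the units, as TOPOLOGICAL groups** (for
topological monoids `R i` with open submonoids `B i`). -/
def unitsContinuousMulEquiv :
    (Πʳ i, [R i, B i])ˣ ≃ₜ* Πʳ i, [(R i)ˣ, (Submonoid.ofClass (B i)).units] :=
  { RestrictedProduct.unitsEquiv R (B := B) (𝓕 := cofinite) with
    continuous_toFun := continuous_unitsEquiv
    continuous_invFun := continuous_unitsEquiv_symm }

/-- (Ported verbatim from the HodgeCMPerL package; no docstring in the source.) -/
@[simp] theorem unitsContinuousMulEquiv_apply (x : (Πʳ i, [R i, B i])ˣ) (i : ι) :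
    unitsContinuousMulEquiv R B x i = RestrictedProduct.unitsEquiv R x i := rfl

/-- (Ported verbatim from the HodgeCMPerL package; no docstring in the source.) -/
theorem coe_unitsContinuousMulEquiv_apply (x : (Πʳ i, [R i, B i])ˣ) (i : ι) :
    ((unitsContinuousMulEquiv R B x i : (R i)ˣ) : R i) = (x : Πʳ i, [R i, B i]) i := rfl

end units

/-! ## §3  Finite ideles and ideles -/

section ideles

open IsDedekindDomain NumberField

variable (R K : Type*) [CommRing R] [IsDedekindDomain R] [Field K] [Algebra R K] [IsFractionRing R K]

/-- (Ported verbatim from the HodgeCMPerL package; no docstring in the source.) -/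
instance fact_isOpen_adicCompletionIntegers :
    Fact (∀ v : HeightOneSpectrum R, IsOpen ((v.adicCompletionIntegers K : Set (v.adicCompletion K)))) :=
  ⟨fun _ => Valued.isOpen_valuationSubring _⟩

/-- **The finite ideles are the restricted product of the `K_vˣ` with respect to the `𝒪_vˣ`**, as
topological groups. -/
def finiteAdeleUnitsEquiv :
    (FiniteAdeleRing R K)ˣ ≃ₜ*
      Πʳ v : HeightOneSpectrum R, [(v.adicCompletion K)ˣ,
        (Submonoid.ofClass (v.adicCompletionIntegers K)).units] :=
  unitsContinuousMulEquiv (fun v : HeightOneSpectrum R => v.adicCompletion K)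
    (fun v : HeightOneSpectrum R => v.adicCompletionIntegers K)

/-- (Ported verbatim from the HodgeCMPerL package; no docstring in the source.) -/
theorem coe_finiteAdeleUnitsEquiv_apply (x : (FiniteAdeleRing R K)ˣ) (v : HeightOneSpectrum R) :
    ((finiteAdeleUnitsEquiv R K x v : (v.adicCompletion K)ˣ) : v.adicCompletion K) =
      (x : FiniteAdeleRing R K) v := rfl

variable (L : Type*) [Field L] [NumberField L]

/-- **The ideles of a number field**: `𝔸_Lˣ ≃ₜ (L_∞)ˣ × Πʳ_v [(L_v)ˣ, (𝒪_v)ˣ]` (pv10's `ideleGroupSplit`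
followed by `finiteAdeleUnitsEquiv` on the finite part). -/
def ideleGroupEquiv :
    ideleGroup L ≃ₜ (InfiniteAdeleRing L)ˣ ×
      Πʳ v : HeightOneSpectrum (𝓞 L), [(v.adicCompletion L)ˣ,
        (Submonoid.ofClass (v.adicCompletionIntegers L)).units] :=
  (ideleGroupSplit L).trans
    ((Homeomorph.refl _).prodCongr (finiteAdeleUnitsEquiv (𝓞 L) L).toHomeomorph)

/-- (Ported verbatim from the HodgeCMPerL package; no docstring in the source.) -/
theorem ideleGroupEquiv_snd_apply (x : ideleGroup L) (v : HeightOneSpectrum (𝓞 L)) :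
    (((ideleGroupEquiv L x).2 v : (v.adicCompletion L)ˣ) : v.adicCompletion L) =
      (x : AdeleRing (𝓞 L) L).2 v := rfl

end ideles

end HodgeCM.PerL34.RestrictedUnits

end
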